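import Summits.QuantumFields.YangMills.Theorems.CentreWallReflectionSlabPolyakov
import HarnessLib

/-!
# Slab decomposition of the four-torus Wilson weight, Vb: wall weights, pinned plaquettes and the integrated flip bound
# (crux `CentreWallReflection.WallReflection` ⟨stmt-QuantumFields-23707⟩, line `birth`, stub `stub_instantiate`; planner ym-idea-4 g18)

The wall weights `N_t = ∫ 𝟙_W(P_t) e^{−βS}`, the absolute pinned-plaquette bound `∫ 𝟙[s₀ ≤ c_p] e^{−βS} ≤ e^{−βs₀}`, the pointwise and the
INTEGRATED FLIP BOUND `∫𝟙[O(P_m) ≠ O(P_0)] e^{−βS} ≤ Σ_{t<m}(N_t + N_{t+1}) + m(n+1) e^{−βδ/(n+1)²}`.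
HONEST FRAMING: lattice bookkeeping toward ONE crux of a draft route (fixed torus, finite lattice); nothing here proves the route's target
`MarginalTwistOnset.FixedTorusCriterionFailure`, any continuum statement, or the Yang–Mills mass gap.  THEOREMS ONLY (no `def`, no `sorry`),
standard axioms.  References: [cite: OsterwalderSeiler1978, §2]; [cite: tHooft1979]; E. T. Tomboulis, L. G. Yaffe, CMP 100 (1985) 313;
[cite: Luscher1983, §2].
-/

set_option autoImplicit false

noncomputable section

open scoped BigOperators
open MeasureTheory Literature.MathematicalPhysics.QuantumFieldTheory

namespace Summit.QuantumFields.YangMills.Theorems.CentreWallReflection.Slab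

open MeasureTheory

/-! ## §15 Torus weights: walls, flips, pinned plaquettes -/

section Weights

variable {n : ℕ} {G : Type*} [Group G] [TopologicalSpace G] [IsTopologicalGroup G] [CompactSpace G]
  [MeasurableSpace G] [BorelSpace G] [SecondCountableTopology G] {N : ℕ} (ρ : G →* Matrix (Fin N) (Fin N) ℂ) (μ ν : Fin 4)


omit [CompactSpace G] [MeasurableSpace G] [BorelSpace G] [SecondCountableTopology G] in
/-- `continuous_lineHolonomy'` (slab bookkeeping, see the module docstring). -/
theorem continuous_lineHolonomy' (k : Fin 4) : ∀ (m : ℕ) (y : Site 4 (n + 1)), Continuous fun U : (GaugeConfig 4 (n + 1) G) => lineHolonomy U k m y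
  | 0, y => by simpa [lineHolonomy] using continuous_const
  | m + 1, y => by
    simp only [lineHolonomy]
    exact (continuous_apply _).mul (continuous_lineHolonomy' k m (y.shift k))

omit [CompactSpace G] [MeasurableSpace G] [BorelSpace G] [SecondCountableTopology G] in
/-- `continuous_polyakov` (slab bookkeeping, see the module docstring). -/
theorem continuous_polyakov (t : ℕ) : Continuous fun W : (GaugeConfig 4 (n + 1) G) => polyakov μ ν t W := continuous_lineHolonomy' ν _ _

omit [CompactSpace G] in
/-- `measurable_polyakov` (slab bookkeeping, see the module docstring). -/
theorem measurable_polyakov (t : ℕ) : Measurable fun W : (GaugeConfig 4 (n + 1) G) => polyakov μ ν t W := (continuous_polyakov μ ν t).measurable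

omit [TopologicalSpace G] [IsTopologicalGroup G] [CompactSpace G] [MeasurableSpace G] [BorelSpace G] [SecondCountableTopology G] in
/-- `boltz_pos` (slab bookkeeping, see the module docstring). -/
theorem boltz_pos (β : ℝ) (W : (GaugeConfig 4 (n + 1) G)) : 0 < boltz ρ β W := Real.exp_pos _

omit [TopologicalSpace G] [IsTopologicalGroup G] [CompactSpace G] [MeasurableSpace G] [BorelSpace G] [SecondCountableTopology G] in
/-- `boltz_le_one` (slab bookkeeping, see the module docstring). -/
theorem boltz_le_one (hU : ∀ g, ρ g ∈ Matrix.unitaryGroup (Fin N) ℂ) {β : ℝ} (hβ : 0 ≤ β) (W : (GaugeConfig 4 (n + 1) G)) : boltz ρ β W ≤ 1 :=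
  (le_abs_self _).trans (abs_exp_neg_le_one hβ (Finset.sum_nonneg fun p _ => plaqCost_nonneg ρ hU W p))

omit [CompactSpace G] in
/-- `measurable_boltz` (slab bookkeeping, see the module docstring). -/
theorem measurable_boltz (hρ : Continuous ρ) (β : ℝ) : Measurable (boltz (n := n) ρ β) :=
  Real.continuous_exp.measurable.comp ((continuous_finsetSum _ fun p _ => continuous_plaqCost ρ hρ p).measurable.const_mul β).neg

omit [SecondCountableTopology G] in
/-- **Pinned plaquette, absolute bound**: `∫ 𝟙[s₀ ≤ c_p] e^{−βS} ≤ e^{−β s₀}`. -/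
theorem integral_pinned_le (hU : ∀ g, ρ g ∈ Matrix.unitaryGroup (Fin N) ℂ) {β : ℝ} (hβ : 0 ≤ β) (s₀ : ℝ)
    (p : Plaquette 4 (n + 1)) :
    ∫ W, {W : (GaugeConfig 4 (n + 1) G) | s₀ ≤ plaqCost ρ W p}.indicator (fun _ => (1 : ℝ)) W * boltz ρ β W ∂(MeasureTheory.Measure.pi (fun _ : Edge 4 (n + 1) => haarProbability G)) ≤ Real.exp (-(β * s₀)) := by
  have hpt : ∀ W : (GaugeConfig 4 (n + 1) G), {W : (GaugeConfig 4 (n + 1) G) | s₀ ≤ plaqCost ρ W p}.indicator (fun _ => (1 : ℝ)) W * boltz ρ β W ≤ Real.exp (-(β * s₀)) := by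
    intro W
    by_cases h : s₀ ≤ plaqCost ρ W p
    · rw [Set.indicator_of_mem (show W ∈ {W : (GaugeConfig 4 (n + 1) G) | s₀ ≤ plaqCost ρ W p} from h), one_mul]
      refine Real.exp_le_exp.mpr (neg_le_neg (mul_le_mul_of_nonneg_left (h.trans ?_) hβ))
      exact Finset.single_le_sum (f := fun p => plaqCost ρ W p) (fun p _ => plaqCost_nonneg ρ hU W p) (Finset.mem_univ p)
    · rw [Set.indicator_of_notMem (show W ∉ {W : (GaugeConfig 4 (n + 1) G) | s₀ ≤ plaqCost ρ W p} from h), zero_mul]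
      exact (Real.exp_pos _).le
  calc ∫ W, {W : (GaugeConfig 4 (n + 1) G) | s₀ ≤ plaqCost ρ W p}.indicator (fun _ => (1 : ℝ)) W * boltz ρ β W ∂(MeasureTheory.Measure.pi (fun _ : Edge 4 (n + 1) => haarProbability G))
      ≤ ∫ _W : (GaugeConfig 4 (n + 1) G), Real.exp (-(β * s₀)) ∂(MeasureTheory.Measure.pi (fun _ : Edge 4 (n + 1) => haarProbability G)) :=
        integral_mono_of_nonneg (ae_of_all _ fun W => mul_nonneg (Set.indicator_nonneg (fun _ _ => zero_le_one) _) (boltz_pos ρ β W).le)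
          (integrable_const _) (ae_of_all _ hpt)
    _ = Real.exp (-(β * s₀)) := by simp

omit [TopologicalSpace G] [IsTopologicalGroup G] [CompactSpace G] [MeasurableSpace G] [BorelSpace G] [SecondCountableTopology G] in
/-- **Pointwise flip bound.** If the labels of slices `0` and `m` differ, then some consecutive pair `t < m` has a wall end or a pinned
ladder plaquette. -/
theorem flip_indicator_le (hU : ∀ g, ρ g ∈ Matrix.unitaryGroup (Fin N) ℂ) (hμν : μ < ν) {O : G → ℕ} {Wset : Set G} {δ : ℝ}
    (hOc : ∀ g h : G, O (h * g * h⁻¹) = O g) (hWc : ∀ g h : G, h * g * h⁻¹ ∈ Wset ↔ g ∈ Wset)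
    (hloc : ∀ g g' : G, (N : ℝ) - (ρ (g⁻¹ * g')).trace.re < δ → g ∉ Wset → g' ∉ Wset → O g = O g')
    (m : ℕ) (W : (GaugeConfig 4 (n + 1) G)) :
    {W : (GaugeConfig 4 (n + 1) G) | O (polyakov μ ν m W) ≠ O (polyakov μ ν 0 W)}.indicator (fun _ => (1 : ℝ)) W ≤
      ∑ t ∈ Finset.range m, (Wset.indicator (fun _ => (1 : ℝ)) (polyakov μ ν t W) +
        Wset.indicator (fun _ => (1 : ℝ)) (polyakov μ ν (t + 1) W) +
        ∑ s ∈ Finset.range (n + 1), {W : (GaugeConfig 4 (n + 1) G) | δ / (((n + 1 : ℕ) : ℝ) ^ 2) ≤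
          plaqCost ρ W (baseSite μ t + Pi.single ν (s : ZMod (n + 1)), ⟨(μ, ν), hμν⟩)}.indicator (fun _ => (1 : ℝ)) W) := by
  have h0 : ∀ (S : Set G) (g : G), 0 ≤ S.indicator (fun _ => (1 : ℝ)) g := fun S g => Set.indicator_nonneg (fun _ _ => zero_le_one) _
  have h0' : ∀ (S : Set (GaugeConfig 4 (n + 1) G)) (V : (GaugeConfig 4 (n + 1) G)), 0 ≤ S.indicator (fun _ => (1 : ℝ)) V := fun S V => Set.indicator_nonneg (fun _ _ => zero_le_one) _
  have hterm0 : ∀ t, 0 ≤ Wset.indicator (fun _ => (1 : ℝ)) (polyakov μ ν t W) +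
      Wset.indicator (fun _ => (1 : ℝ)) (polyakov μ ν (t + 1) W) +
      ∑ s ∈ Finset.range (n + 1), {W : (GaugeConfig 4 (n + 1) G) | δ / (((n + 1 : ℕ) : ℝ) ^ 2) ≤
        plaqCost ρ W (baseSite μ t + Pi.single ν (s : ZMod (n + 1)), ⟨(μ, ν), hμν⟩)}.indicator (fun _ => (1 : ℝ)) W :=
    fun t => add_nonneg (add_nonneg (h0 _ _) (h0 _ _)) (Finset.sum_nonneg fun s _ => h0' _ _)
  by_cases hflip : O (polyakov μ ν m W) ≠ O (polyakov μ ν 0 W)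
  · rw [Set.indicator_of_mem (show W ∈ {W : (GaugeConfig 4 (n + 1) G) | O (polyakov μ ν m W) ≠ O (polyakov μ ν 0 W)} from hflip)]
    obtain ⟨t, ht, hne⟩ := exists_bond_of_ne (μ := μ) (ν := ν) m W hflip
    refine le_trans ?_ (Finset.single_le_sum (fun t _ => hterm0 t) ht)
    rcases bond_dichotomy ρ hU hOc hWc hloc t W hne with hw | hw | ⟨s, hs, hle⟩
    · rw [Set.indicator_of_mem hw]
      linarith [h0 Wset (polyakov μ ν (t + 1) W), Finset.sum_nonneg fun s (_ : s ∈ Finset.range (n + 1)) =>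
        h0' {W : (GaugeConfig 4 (n + 1) G) | δ / (((n + 1 : ℕ) : ℝ) ^ 2) ≤ plaqCost ρ W (baseSite μ t + Pi.single ν (s : ZMod (n + 1)), ⟨(μ, ν), hμν⟩)} W]
    · rw [Set.indicator_of_mem hw]
      linarith [h0 Wset (polyakov μ ν t W), Finset.sum_nonneg fun s (_ : s ∈ Finset.range (n + 1)) =>
        h0' {W : (GaugeConfig 4 (n + 1) G) | δ / (((n + 1 : ℕ) : ℝ) ^ 2) ≤ plaqCost ρ W (baseSite μ t + Pi.single ν (s : ZMod (n + 1)), ⟨(μ, ν), hμν⟩)} W]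
    · have h1 : (1 : ℝ) ≤ ∑ s ∈ Finset.range (n + 1), {W : (GaugeConfig 4 (n + 1) G) | δ / (((n + 1 : ℕ) : ℝ) ^ 2) ≤
          plaqCost ρ W (baseSite μ t + Pi.single ν (s : ZMod (n + 1)), ⟨(μ, ν), hμν⟩)}.indicator (fun _ => (1 : ℝ)) W := by
        refine le_trans ?_ (Finset.single_le_sum (fun s _ => h0' _ _) hs)
        rw [Set.indicator_of_mem (show W ∈ {W : (GaugeConfig 4 (n + 1) G) | δ / (((n + 1 : ℕ) : ℝ) ^ 2) ≤
          plaqCost ρ W (baseSite μ t + Pi.single ν (s : ZMod (n + 1)), ⟨(μ, ν), hμν⟩)} from hle)]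
      linarith [h0 Wset (polyakov μ ν t W), h0 Wset (polyakov μ ν (t + 1) W)]
  · rw [Set.indicator_of_notMem (show W ∉ {W : (GaugeConfig 4 (n + 1) G) | O (polyakov μ ν m W) ≠ O (polyakov μ ν 0 W)} from hflip)]
    exact Finset.sum_nonneg fun t _ => hterm0 t

omit [SecondCountableTopology G] in
/-- `wallWeight_nonneg` (slab bookkeeping, see the module docstring). -/
theorem wallWeight_nonneg (β : ℝ) (Wset : Set G) (t : ℕ) : 0 ≤ wallWeight (n := n) ρ μ ν β Wset t :=
  integral_nonneg fun W => mul_nonneg (Set.indicator_nonneg (fun _ _ => zero_le_one) _) (boltz_pos ρ β W).le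

omit [SecondCountableTopology G] in
/-- Shifted partial sums of wall weights are bounded by the full sum. -/
theorem sum_wallWeight_shift_le (β : ℝ) (Wset : Set G) {m : ℕ} (hm : m ≤ n) :
    ∑ t ∈ Finset.range m, (wallWeight (n := n) ρ μ ν β Wset t + wallWeight (n := n) ρ μ ν β Wset (t + 1)) ≤
      2 * ∑ t ∈ Finset.range (n + 1), wallWeight (n := n) ρ μ ν β Wset t := by
  rw [Finset.sum_add_distrib, two_mul]
  have h0 := fun t => wallWeight_nonneg (n := n) ρ μ ν β Wset t
  refine add_le_add ?_ ?_
  · exact Finset.sum_le_sum_of_subset_of_nonneg (Finset.range_subset_range.mpr (by omega)) fun t _ _ => h0 t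
  · have h1 : ∑ t ∈ Finset.range m, wallWeight (n := n) ρ μ ν β Wset (t + 1) ≤ ∑ t ∈ Finset.range (m + 1), wallWeight (n := n) ρ μ ν β Wset t := by
      rw [Finset.sum_range_succ']; linarith [h0 0]
    exact h1.trans (Finset.sum_le_sum_of_subset_of_nonneg (Finset.range_subset_range.mpr (by omega)) fun t _ _ => h0 t)

/-- **Integrated flip bound**: the periodic weight of a label change between slices `0` and `m` is at most
`Σ_{t<m} (N_t + N_{t+1}) + m (n+1) e^{−β δ/(n+1)²}`. -/
theorem integral_flip_le (hρ : Continuous ρ) (hU : ∀ g, ρ g ∈ Matrix.unitaryGroup (Fin N) ℂ) (hμν : μ < ν) {β : ℝ} (hβ : 0 ≤ β)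
    {O : G → ℕ} (hOm : Measurable O) {Wset : Set G} (hWm : MeasurableSet Wset) {δ : ℝ}
    (hOc : ∀ g h : G, O (h * g * h⁻¹) = O g) (hWc : ∀ g h : G, h * g * h⁻¹ ∈ Wset ↔ g ∈ Wset)
    (hloc : ∀ g g' : G, (N : ℝ) - (ρ (g⁻¹ * g')).trace.re < δ → g ∉ Wset → g' ∉ Wset → O g = O g') (m : ℕ) :
    ∫ W, {W : (GaugeConfig 4 (n + 1) G) | O (polyakov μ ν m W) ≠ O (polyakov μ ν 0 W)}.indicator (fun _ => (1 : ℝ)) W * boltz ρ β W ∂(MeasureTheory.Measure.pi (fun _ : Edge 4 (n + 1) => haarProbability G)) ≤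
      ∑ t ∈ Finset.range m, (wallWeight (n := n) ρ μ ν β Wset t + wallWeight (n := n) ρ μ ν β Wset (t + 1)) +
        (m : ℝ) * ((n + 1 : ℕ) : ℝ) * Real.exp (-(β * (δ / (((n + 1 : ℕ) : ℝ) ^ 2)))) := by
  set s₀ : ℝ := δ / (((n + 1 : ℕ) : ℝ) ^ 2) with hs₀
  -- the summands
  set a : ℕ → (GaugeConfig 4 (n + 1) G) → ℝ := fun t W => Wset.indicator (fun _ => (1 : ℝ)) (polyakov μ ν t W) * boltz ρ β W with ha
  set c : ℕ → ℕ → (GaugeConfig 4 (n + 1) G) → ℝ := fun t s W => {W : (GaugeConfig 4 (n + 1) G) | s₀ ≤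
    plaqCost ρ W (baseSite μ t + Pi.single ν (s : ZMod (n + 1)), ⟨(μ, ν), hμν⟩)}.indicator (fun _ => (1 : ℝ)) W * boltz ρ β W with hc
  have hbm := measurable_boltz ρ hρ β (n := n)
  have ham : ∀ t, Measurable (a t) := fun t =>
    ((measurable_const.indicator hWm).comp (measurable_polyakov μ ν t)).mul hbm
  have hcm : ∀ t s, Measurable (c t s) := fun t s =>
    (measurable_const.indicator (measurableSet_le measurable_const ((continuous_plaqCost ρ hρ _).measurable))).mul hbm
  have hbd1 : ∀ (S : Set G) (g : G) (W : (GaugeConfig 4 (n + 1) G)), |S.indicator (fun _ => (1 : ℝ)) g * boltz ρ β W| ≤ 1 := by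
    intro S g W
    rw [abs_mul, abs_of_pos (boltz_pos ρ β W)]
    calc |S.indicator (fun _ => (1 : ℝ)) g| * boltz ρ β W ≤ 1 * 1 := by
          refine mul_le_mul ?_ (boltz_le_one ρ hU hβ W) (boltz_pos ρ β W).le zero_le_one
          by_cases h : g ∈ S <;> simp [h]
      _ = 1 := one_mul _
  have hbd2 : ∀ (S : Set (GaugeConfig 4 (n + 1) G)) (W : (GaugeConfig 4 (n + 1) G)), |S.indicator (fun _ => (1 : ℝ)) W * boltz ρ β W| ≤ 1 := by
    intro S W
    rw [abs_mul, abs_of_pos (boltz_pos ρ β W)]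
    calc |S.indicator (fun _ => (1 : ℝ)) W| * boltz ρ β W ≤ 1 * 1 := by
          refine mul_le_mul ?_ (boltz_le_one ρ hU hβ W) (boltz_pos ρ β W).le zero_le_one
          by_cases h : W ∈ S <;> simp [h]
      _ = 1 := one_mul _
  have hai : ∀ t, Integrable (a t) (MeasureTheory.Measure.pi (fun _ : Edge 4 (n + 1) => haarProbability G)) := fun t => integrable_of_bdd (ham t) (fun W => hbd1 _ _ W) _
  have hci : ∀ t s, Integrable (c t s) (MeasureTheory.Measure.pi (fun _ : Edge 4 (n + 1) => haarProbability G)) := fun t s => integrable_of_bdd (hcm t s) (fun W => hbd2 _ W) _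
  -- pointwise bound, multiplied by the Boltzmann weight
  set F : ℕ → (GaugeConfig 4 (n + 1) G) → ℝ := fun t W => a t W + a (t + 1) W + ∑ s ∈ Finset.range (n + 1), c t s W with hF
  have hFi : ∀ t, Integrable (F t) (MeasureTheory.Measure.pi (fun _ : Edge 4 (n + 1) => haarProbability G)) := fun t => ((hai t).add (hai (t + 1))).add (integrable_finsetSum _ fun s _ => hci t s)
  have hpt : ∀ W : (GaugeConfig 4 (n + 1) G), {W : (GaugeConfig 4 (n + 1) G) | O (polyakov μ ν m W) ≠ O (polyakov μ ν 0 W)}.indicator (fun _ => (1 : ℝ)) W * boltz ρ β W ≤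
      ∑ t ∈ Finset.range m, F t W := by
    intro W
    have h := mul_le_mul_of_nonneg_right (flip_indicator_le ρ μ ν hU hμν hOc hWc hloc m W) (boltz_pos ρ β W).le
    refine h.trans (le_of_eq ?_)
    rw [Finset.sum_mul]
    refine Finset.sum_congr rfl fun t _ => ?_
    rw [add_mul, add_mul, Finset.sum_mul]
  have hint_rhs : Integrable (fun W => ∑ t ∈ Finset.range m, F t W) (MeasureTheory.Measure.pi (fun _ : Edge 4 (n + 1) => haarProbability G)) := integrable_finsetSum _ fun t _ => hFi t
  have hFt : ∀ t, ∫ W, F t W ∂(MeasureTheory.Measure.pi (fun _ : Edge 4 (n + 1) => haarProbability G)) = ∫ W, a t W ∂(MeasureTheory.Measure.pi (fun _ : Edge 4 (n + 1) => haarProbability G)) + ∫ W, a (t + 1) W ∂(MeasureTheory.Measure.pi (fun _ : Edge 4 (n + 1) => haarProbability G)) + ∑ s ∈ Finset.range (n + 1), ∫ W, c t s W ∂(MeasureTheory.Measure.pi (fun _ : Edge 4 (n + 1) => haarProbability G)) := by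
    intro t
    simp only [hF]
    rw [integral_add (f := fun W => a t W + a (t + 1) W) (g := fun W => ∑ s ∈ Finset.range (n + 1), c t s W)
        ((hai t).add (hai (t + 1))) (integrable_finsetSum _ fun s _ => hci t s),
      integral_add (hai t) (hai (t + 1)), integral_finsetSum _ fun s _ => hci t s]
  have hint_lhs : Integrable (fun W => {W : (GaugeConfig 4 (n + 1) G) | O (polyakov μ ν m W) ≠ O (polyakov μ ν 0 W)}.indicator (fun _ => (1 : ℝ)) W *
      boltz ρ β W) (MeasureTheory.Measure.pi (fun _ : Edge 4 (n + 1) => haarProbability G)) := by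
    refine integrable_of_bdd ?_ (fun W => hbd2 _ W) _
    exact (measurable_const.indicator ((measurableSet_eq_fun (hOm.comp (measurable_polyakov μ ν m))
      (hOm.comp (measurable_polyakov μ ν 0))).compl)).mul hbm
  calc ∫ W, {W : (GaugeConfig 4 (n + 1) G) | O (polyakov μ ν m W) ≠ O (polyakov μ ν 0 W)}.indicator (fun _ => (1 : ℝ)) W * boltz ρ β W ∂(MeasureTheory.Measure.pi (fun _ : Edge 4 (n + 1) => haarProbability G))
      ≤ ∫ W, ∑ t ∈ Finset.range m, F t W ∂(MeasureTheory.Measure.pi (fun _ : Edge 4 (n + 1) => haarProbability G)) := integral_mono hint_lhs hint_rhs hpt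
    _ = ∑ t ∈ Finset.range m, (∫ W, a t W ∂(MeasureTheory.Measure.pi (fun _ : Edge 4 (n + 1) => haarProbability G)) + ∫ W, a (t + 1) W ∂(MeasureTheory.Measure.pi (fun _ : Edge 4 (n + 1) => haarProbability G)) + ∑ s ∈ Finset.range (n + 1), ∫ W, c t s W ∂(MeasureTheory.Measure.pi (fun _ : Edge 4 (n + 1) => haarProbability G))) := by
        rw [integral_finsetSum _ fun t _ => hFi t]
        exact Finset.sum_congr rfl fun t _ => hFt t
    _ ≤ ∑ t ∈ Finset.range m, (wallWeight (n := n) ρ μ ν β Wset t + wallWeight (n := n) ρ μ ν β Wset (t + 1) +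
          ∑ _s ∈ Finset.range (n + 1), Real.exp (-(β * s₀))) := by
        refine Finset.sum_le_sum fun t _ => add_le_add (le_of_eq rfl) (Finset.sum_le_sum fun s _ => ?_)
        exact integral_pinned_le ρ hU hβ s₀ _
    _ = ∑ t ∈ Finset.range m, (wallWeight (n := n) ρ μ ν β Wset t + wallWeight (n := n) ρ μ ν β Wset (t + 1)) +
          (m : ℝ) * ((n + 1 : ℕ) : ℝ) * Real.exp (-(β * s₀)) := by
        rw [Finset.sum_add_distrib, Finset.sum_const, Finset.card_range, nsmul_eq_mul, Finset.sum_const, Finset.card_range,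
          nsmul_eq_mul, mul_assoc]

end Weights

end Summit.QuantumFields.YangMills.Theorems.CentreWallReflection.Slab

end
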